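import Mathlib
import HarnessLib
import Literature.Analysis.FluidPDE.TypeIAncientMild
import Summits.NavierStokesRegularity.NavierStokesRegularity.Theorems.PoloidalWindowDoorPoloidalWindowRigidityPoloidalExtremal
import Summits.NavierStokesRegularity.NavierStokesRegularity.Theorems.PoloidalWindowDoorPoloidalWindowRigidityPoloidalExtremalBlowDown
import Summits.NavierStokesRegularity.NavierStokesRegularity.Theorems.PoloidalWindowDoorPoloidalWindowRigidityPoloidalExtremalRecurrent

/-!
# Route `PoloidalWindowDoor`, crux `PoloidalWindowRigidity` (K2, stmt-NavierStokesRegularity-19708) —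
# the NORMAL FORM of the residue S2′: an extremal, blow-down-recurrent poloidal profile

Cell ns-regularity-ideate, K2 lead ns-poloidal-K2-p1 (support file, `--supports stmt-…-19708 --as helper`; task (H1d) corollary,
assembling `…PoloidalExtremal.exists_poloidal_extremal` (p469616), `…PoloidalExtremalBlowDown.poloidal_extremal_blowDown_extremal`
(p470559) and `…PoloidalExtremalRecurrent.exists_selfBlowDown_poloidal` (p471740)).

`exists_selfRecurrent_poloidal_extremal`: if SOME poloidal frozen element of SOME KNSS Type-I class 𝔓(C) is nontrivial, then there are
`C⋆ > 0` and a poloidal frozen `W ∈ 𝔓(C⋆)` with `‖W(−1,0)‖ = C⋆` (sub-class-minimal, hot-spot bound `√(−t)‖W(t,x)‖ ≤ ‖W(−1,0)‖`) which is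
RECURRENT under blow-down modulo translations: `λ_j W(λ_j² t, x_j + λ_j x) → W(t,x)` for all `t < 0`, `x`, along some `λ_j → ∞`.
So the residue prover of S2′ may assume WLOG that the profile is extremal AND self-recurrent (the soft half of any «almost-periodic
critical element» strategy, KNSS/Kenig–Merle style, inside the poloidal class).

WHAT THIS IS NOT: not a claim about Navier–Stokes regularity and not the residue — a normal form, bears_on LADDER-NS N0,
rung N0-LocalTubeDoorPoloidal.
-/

noncomputable section

-- the summit and its single sub-problem share the name (CONVENTIONS §1), as in every Theorems file
set_option linter.dupNamespace false

namespace Summit.NavierStokesRegularity.NavierStokesRegularity.Theorems.PoloidalWindowDoorPoloidalWindowRigidityPoloidalExtremalSelfRecurrent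

open MeasureTheory Set Function Filter Topology
open scoped RealInnerProductSpace InnerProductSpace
open Literature.Analysis Literature.Analysis.FluidPDE
open Summit.NavierStokesRegularity.NavierStokesRegularity.Theorems.PoloidalWindowDoorPoloidalWindowRigidityPoloidalExtremal
open Summit.NavierStokesRegularity.NavierStokesRegularity.Theorems.PoloidalWindowDoorPoloidalWindowRigidityPoloidalExtremalBlowDown
open Summit.NavierStokesRegularity.NavierStokesRegularity.Theorems.PoloidalWindowDoorPoloidalWindowRigidityPoloidalExtremalRecurrent

/-- **A self-recurrent extremal poloidal profile (normal form for S2′).**  If some poloidal frozen element of some KNSS Type-I class is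
nontrivial, then there are `C⋆ > 0` and a poloidal frozen `W ∈ 𝔓(C⋆)` with `‖W(−1,0)‖ = C⋆`, the hot-spot bound, `C⋆` minimal among the
constants of nontrivial poloidal frozen elements, and scales `λ_j → ∞`, centres `x_j` with `λ_j W(λ_j² t, x_j + λ_j x) → W(t,x)` on the slab. -/
theorem exists_selfRecurrent_poloidal_extremal
    (hex : ∃ (C : ℝ) (u : ℝ → EuclideanSpace ℝ (Fin 3) → EuclideanSpace ℝ (Fin 3)), IsTypeIAncientMild C u ∧
      (∀ s < 0, ∀ y, ⟪curl (u s) y, EuclideanSpace.single 2 (1 : ℝ)⟫_ℝ = 0) ∧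
      (∀ s < 0, ∀ y, ⟪fderiv ℝ (u s) y (curl (u s) y), EuclideanSpace.single 2 (1 : ℝ)⟫_ℝ = 0) ∧
      ∃ t < 0, ∃ x, u t x ≠ 0) :
    ∃ (Cs : ℝ) (W : ℝ → EuclideanSpace ℝ (Fin 3) → EuclideanSpace ℝ (Fin 3)), 0 < Cs ∧ IsTypeIAncientMild Cs W ∧
      (∀ s < 0, ∀ y, ⟪curl (W s) y, EuclideanSpace.single 2 (1 : ℝ)⟫_ℝ = 0) ∧
      (∀ s < 0, ∀ y, ⟪fderiv ℝ (W s) y (curl (W s) y), EuclideanSpace.single 2 (1 : ℝ)⟫_ℝ = 0) ∧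
      ‖W (-1) 0‖ = Cs ∧
      (∀ t < 0, ∀ x, Real.sqrt (-t) * ‖W t x‖ ≤ ‖W (-1) 0‖) ∧
      (∀ (C' : ℝ) (u' : ℝ → EuclideanSpace ℝ (Fin 3) → EuclideanSpace ℝ (Fin 3)), IsTypeIAncientMild C' u' →
        (∀ s < 0, ∀ y, ⟪curl (u' s) y, EuclideanSpace.single 2 (1 : ℝ)⟫_ℝ = 0) →
        (∀ s < 0, ∀ y, ⟪fderiv ℝ (u' s) y (curl (u' s) y), EuclideanSpace.single 2 (1 : ℝ)⟫_ℝ = 0) →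
        (∃ t < 0, ∃ x, u' t x ≠ 0) → Cs ≤ C') ∧
      ∃ (lam : ℕ → ℝ) (xs : ℕ → EuclideanSpace ℝ (Fin 3)), (∀ j, 0 < lam j) ∧ Tendsto lam atTop atTop ∧
        ∀ t < (0 : ℝ), ∀ x, Tendsto (fun j => lam j • W (lam j ^ 2 * t) (xs j + lam j • x)) atTop (𝓝 (W t x)) := by
  obtain ⟨Cs, W₀, hCs, hW₀, hpol₀, hfro₀, hnorm₀, -, hmin⟩ := exists_poloidal_extremal hex
  have hbd : ∀ W : ℝ → EuclideanSpace ℝ (Fin 3) → EuclideanSpace ℝ (Fin 3),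
      IsTypeIAncientMild Cs W → (∀ s < 0, ∀ y, ⟪curl (W s) y, EuclideanSpace.single 2 (1 : ℝ)⟫_ℝ = 0) →
        (∀ s < 0, ∀ y, ⟪fderiv ℝ (W s) y (curl (W s) y), EuclideanSpace.single 2 (1 : ℝ)⟫_ℝ = 0) → ‖W (-1) 0‖ = Cs →
      ∃ W' : ℝ → EuclideanSpace ℝ (Fin 3) → EuclideanSpace ℝ (Fin 3),
        IsTypeIAncientMild Cs W' ∧ (∀ s < 0, ∀ y, ⟪curl (W' s) y, EuclideanSpace.single 2 (1 : ℝ)⟫_ℝ = 0) ∧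
          (∀ s < 0, ∀ y, ⟪fderiv ℝ (W' s) y (curl (W' s) y), EuclideanSpace.single 2 (1 : ℝ)⟫_ℝ = 0) ∧ ‖W' (-1) 0‖ = Cs ∧
        ∃ (lam : ℕ → ℝ) (xs : ℕ → EuclideanSpace ℝ (Fin 3)), (∀ j, 0 < lam j) ∧ Tendsto lam atTop atTop ∧
          ∀ t < (0 : ℝ), ∀ x, Tendsto (fun j => lam j • W (lam j ^ 2 * t) (xs j + lam j • x)) atTop (𝓝 (W' t x)) := by
    intro W hW hp hf hn
    obtain ⟨lam, xs, W', hpos, htop, hconv, hW'A, hW'p, hW'f, hW'n⟩ :=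
      poloidal_extremal_blowDown_extremal hCs hW hp hf hn hmin
    exact ⟨W', hW'A, hW'p, hW'f, hW'n, lam, xs, hpos, htop, hconv⟩
  obtain ⟨W, hW, hWp, hWf, hWn, hrec⟩ := exists_selfBlowDown_poloidal ⟨W₀, hW₀, hpol₀, hfro₀, hnorm₀⟩ hbd
  have hhot : ∀ t < 0, ∀ x, Real.sqrt (-t) * ‖W t x‖ ≤ ‖W (-1) 0‖ := fun t ht x => by
    rw [hWn, ← le_div_iff₀' (Real.sqrt_pos.2 (neg_pos.2 ht))]
    exact hW.norm_le ht x
  exact ⟨Cs, W, hCs, hW, hWp, hWf, hWn, hhot, hmin, hrec⟩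

end Summit.NavierStokesRegularity.NavierStokesRegularity.Theorems.PoloidalWindowDoorPoloidalWindowRigidityPoloidalExtremalSelfRecurrent
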